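import Summits.ABC.IUTFork.DAGTop
import Summits.ABC.IUTFork.Cor312PinnedRegionsThreePins
import Summits.ABC.IUTFork.Cor312StatementBridges
import Summits.ABC.IUTFork.Cor312PilotIdelesPrCapstone
import Summits.ABC.IUTFork.Thm311Real3
import HarnessLib

/-!
# Branch C certificate, INTAKE companion 1: `abc_of_S_v1` AT THE GENUINE REAL DATA OF RECORD — the [PIN] binder
# `hBridge` and the [CONE] binder `hKumB` DISCHARGED BY NAME (`abc_of_S_shrink1`)

C scoreboard, companion Shrink1 (`abc_of_S_shrink1`): S 1 · PIN 1 · FACT 0 · CONE 1 · READ 2 · SIDE 4 = 9 (explicit) / EFFECTIVE 42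
EFFECTIVE Prop hypotheses: explicit 11 + transitive structure fields 31 = 42 [FACT-LIST 1 · SUMMIT-PROP 0 · LITERATURE-PROP 0 · CORE 14 · COMPOUND 16 · other 0 · nested structures 1] (v3: fields of project-structure DATA binders, depth ≤ 4, a nested structure type is expanded once per binder)
Reference (tree `AbcOfS.lean` v1 `abc_of_S_v1`, p428085): S 1 · PIN 2 · FACT 0 · CONE 2 · READ 2 = 7 (explicit) / EFFECTIVE 47 (7 + 40).

(Line 3 = abc-iut-w5-d035's `HypAuditScan.lean` v3 output VERBATIM for `abc_of_S_shrink1`, C-lead ruling C-R1; the tool's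
«explicit 11» = the 9 `Prop` binders listed below + the 2 instance-class binders `[∀ P, NumberField (Fld P)]`,
`[∀ P, NumberField (M P)]` (`NumberField` is `Prop`-valued); the 31 structure-field Props = V 5 · T 14 · A 2 (unchanged apex
inputs) + the well-formedness fields of the genuine containers X 4 (`PilotData`: `S ≠ ∅`, `ord(j_E) < 0` on `S`, `l` prime,
`5 ≤ l`) · lat 2 · sig 2 · split 1 · qData 1 (F-2072 `q_gen`); v1's TI 6 + P312 13 = 19 fields are GONE — `thetaIndex (X P)`
and `settingPrVolSharp …` are constructions.)

PROOF-ONLY companion (no `def`, no new `Prop`, no hypothesis renamed) of `Conditional/AbcOfS.lean` (v1 = `abc_of_S_v1`,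
p428085). It IS `abc_of_S_v1` with two of its data binders INSTANTIATED at constructions that are in the tree — and thereby two
of its seven explicit `Prop` binders filled by LANDED theorems — its 8-line composition BY NAME
(`Cor312Vol.statement_of_pinned3_of_pilotKummerIndRelated` ⟹ `Cor312.Setting.statement_iff_real` + READ ⟹ `DAG.summit_of_cor312`)
repeated verbatim rather than called, so that this companion imports the STABLE modules `DAGTop` / `Cor312PinnedRegionsThreePins` /
`Cor312StatementBridges` and not the hourly-appended `Conditional.AbcOfS` (farm olean coherence; same binder names and order):

* `F P` (the typed lattice situation of [IUTchIII] Thm. 3.11) := abc-iut-c312-5's `Thm311.LatticeSituation.ofShells` over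
  the REAL Dupuy–Hilado-level log-shells `Thm311.Real.logShellsDH (X P) (analyticLogv _)` of the curve's pilot data at the
  ANALYTIC `p_v`-adic logarithms, with abc-iut-c312-1's packet-normalised verbatim container `summandPiecesPr` as
  `Adm`/`logvol`, and the columns' Frobenius-like splitting-monoid images := the line's (`frobΨ n m := Ψ n`: abc-iut-c312-5's
  STRICTIFIED reading of Thm. 3.11 (ii), `Thm311Real3` p408485 — Kummer = identity on the coric carriers; see CAVEAT);
* `P312 P` (the setting of Cor. 3.12) := abc-iut-c312-7's `Thm311.Real.settingPrVolSharp` (p422627): the print-normalised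
  assembled real setting whose Θ-pilot and q-pilot regions are read off ideles `t`, `tq` (abc-iut-c312-3, Dupuy–Hilado §3.3–3.4).

At these data:
* [PIN] `hBridge P : BridgeHyps (P312 P)` IS abc-iut-c312-7's **`bridgeHyps_settingPrVolSharp_of_ideles`** (p424856:
  EVERY field — mono, image_adm, image_fin, hul_nonempty, theta_nonempty, `ThetaFinite` «`−|log(Θ)| ∈ ℝ`» — a theorem),
  modulo the four idele side conditions below;
* [CONE] `hKumB P` (Thm. 3.11 (ii) (b) at column `n`: `frobΨ n m = Ψ n` for every `m`) holds by `rfl` — this is how cone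
  node IUTchIII:Thm3.11(ii) is discharged in the tree (abc-iut-w4-d087 `Thm311PartIIDischarge(Real)` p412807/p412451 on
  c312-5's `Column.partII_iff_ind3_of_coric`).

CAVEAT (honest framing of the second discharge, verbatim from `Thm311PartIIDischarge`): «the content of (ii) beyond
(Ind3)-as-containment — the Kummer isomorphisms as non-identity maps of monoids ([IUTchII] Cor. 4.6 (iii), 4.8 (i)(ii)) … —
is not expressed by the strictified typing and is therefore not discharged here»; it is campaign M's. A reader who wants the
column images kept FREE reads `hKumB` back as one explicit binder (+1).

SCOREBOARD OF THIS COMPANION (same counting rule as `AbcOfS.lean`): explicit `Prop` binders of `abc_of_S_shrink1` =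
S 1 (`hS`) · PIN 1 (`hPin`) · FACT 0 · CONE 1 (`hInd`) · READ 2 (`hΘ`, `hq`) · SIDE 4 (`htq0`, `htq1`, `ht0`, `ht1`: the
ideles are non-zero and units off `S` — inhabited by ideles REALISING `P_q`, `P_Θ` whenever `2l ∣ ord_v(q_v)` on `S`,
abc-iut-c312-3 `exists_realising_qIdeles` / `exists_realising_thetaIdeles`, p420764) = **9**; binders of v1 DISCHARGED: 2
(`hBridge`, `hKumB`); structure-field `Prop`s of v1's data binders `TI` (6) and `P312` (13) no longer inputs (both are now
constructions). MOVEMENT v1 → Shrink1: explicit 7 → 9 (PIN 2→1, CONE 2→1, SIDE 0→4) · EFFECTIVE 47 → 42. What did NOT move: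
S, `hPin`, `hInd`, `hΘ`, `hq` — the apex inputs `V`/`T`/`A` and the two number identifications are the business of the
Diophantine-tail revision (C-lead ruling C-R3, v2), not of this companion.

HONEST FRAMING: this campaign LOCATES / CONDITIONALLY VERIFIES. Nothing here asserts that abc is proved or refuted, or that
[IUTchIII] Cor. 3.12 / Thm. 3.11 holds or fails, or takes a side on any author (Mochizuki / Scholze–Stix / Joshi /
Dupuy–Hilado); «`ABC` follows from S + the listed hypotheses AS TYPED, at these data», nothing more; S is an assumption
label; typed ≠ proved; instantiated ≠ endorsed. [claim: Mochizuki2012, status: disputed] [cite: DupuyHilado2025, §3.3–§3.4]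
-/

noncomputable section

open Set Function NumberField IsDedekindDomain

namespace Summit.ABC.IUTFork.Conditional

open Thm311 Thm311.Real Cor312 Cor312Vol Literature.IUT.LogThetaLattice Literature.IUT.LogVolume
  Literature.IUT.HodgeTheaters

/-! ## §1. One curve: the verbatim Statement of Cor. 3.12 at the genuine real setting from S + pins + idele side conditions -/

section PerCurve

variable {F : Type} [Field F] [NumberField F] (X : PilotData F) (M : Type) [Field M] [NumberField M]
  (archPk : ∀ (j : (thetaIndex X).Label) (vQ : (thetaIndex X).VQ), Set ((logShellsDH X (analyticLogv F)).Packet j vQ))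
  (archSub : ∀ (j : (thetaIndex X).Label) (v : (thetaIndex X).V),
    Set ((logShellsDH X (analyticLogv F)).Packet j ((thetaIndex X).over v)))
  (Ψ : ℤ → ∀ v : (thetaIndex X).V, v ∈ (thetaIndex X).Vbad → Set ((logShellsDH X (analyticLogv F)).StarPacket v))
  (act : ℤ → ∀ v : (thetaIndex X).V, v ∈ (thetaIndex X).Vbad →
    (logShellsDH X (analyticLogv F)).StarPacket v → Module.End ℚ ((logShellsDH X (analyticLogv F)).StarPacket v))
  (Mmod : ℤ → ∀ j : (thetaIndex X).LabelStar, Set ((logShellsDH X (analyticLogv F)).GlobalPacket j.1))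
  (region : ℤ → ∀ j : (thetaIndex X).LabelStar, FinDivisor M → ∀ vQ : (thetaIndex X).VQ,
    Set ((logShellsDH X (analyticLogv F)).Packet j.1 vQ))
  (frobAdm : ℤ → ℤ → ∀ (j : (thetaIndex X).Label) (vQ : (thetaIndex X).VQ),
    Set ((logShellsDH X (analyticLogv F)).Packet j vQ) → Prop)
  (frobLogvol : ℤ → ℤ → ∀ (j : (thetaIndex X).Label) (vQ : (thetaIndex X).VQ),
    Set ((logShellsDH X (analyticLogv F)).Packet j vQ) → ℝ)
  (frobMmod : ℤ → ℤ → ∀ j : (thetaIndex X).LabelStar, Set ((logShellsDH X (analyticLogv F)).GlobalPacket j.1))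
  (unitImage : ℤ → ℤ → ℕ → ∀ (j : (thetaIndex X).Label) (vQ : (thetaIndex X).VQ),
    Set ((logShellsDH X (analyticLogv F)).Packet j vQ))
  (ballImage : ℤ → ℤ → ∀ (j : (thetaIndex X).Label) (vQ : (thetaIndex X).VQ),
    Set ((logShellsDH X (analyticLogv F)).Packet j vQ))
  (thetaDiv : ℤ → ℤ → LgpDivisor M (thetaIndex X).lstar)
  (n : ℤ) {HT : Type} {LogLink : HT → HT → Type} {IsFull : ∀ {s t : HT}, LogLink s t → Prop}
  (lat : LGPGaussianLogThetaLattice LogLink IsFull)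
  {Frd : Type} {IsoF : Frd → Frd → Type} {Ob : Frd → Type} {realify : Frd → Frd} {Strip : Type}
  {IsoS : Strip → Strip → Type} {Mv : ∀ v : (thetaIndex X).V, v ∈ (thetaIndex X).Vbad → Type}
  [∀ v h, Monoid (Mv v h)]
  (sig : GlobalLGPFrobenioidSignature (thetaIndex X).lstar (thetaIndex X).V (· ∈ (thetaIndex X).Vbad)
    Frd IsoF Ob realify Strip IsoS Mv)
  (split : SplittingMonoids Mv) {ObΔ : Type} {N : ∀ v : (thetaIndex X).V, v ∈ (thetaIndex X).Vbad → Type}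
  [∀ v h, Monoid (N v h)] (qData : QPilotData ObΔ N)
  (t : ∀ (pp : Nat.Primes) (_ : Fin X.lstar) (x : (thetaIndex X).Fibre (.inr pp)),
    haveI : Fact (pp : ℕ).Prime := ⟨pp.2⟩; kOf X pp.1 x)
  (tq : ∀ (pp : Nat.Primes) (x : (thetaIndex X).Fibre (.inr pp)), haveI : Fact (pp : ℕ).Prime := ⟨pp.2⟩; kOf X pp.1 x)
  (ρ : (∀ v : (thetaIndex X).V, v ∈ (thetaIndex X).Vbad → Set ((logShellsDH X (analyticLogv F)).StarPacket v)) →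
    ∀ (j : (thetaIndex X).Label) (vQ : (thetaIndex X).VQ), Set ((logShellsDH X (analyticLogv F)).Packet j vQ))
  (qK : ∀ v : (thetaIndex X).V, v ∈ (thetaIndex X).Vbad → Set ((logShellsDH X (analyticLogv F)).StarPacket v))

/-- **One curve, genuine real data: the VERBATIM Statement of [IUTchIII] Cor. 3.12 (`−|log(Θ)| ∈ ℝ ∧ −|log(q)| ≤ −|log(Θ)|`)
for abc-iut-c312-7's print-normalised assembled real setting `settingPrVolSharp` over abc-iut-c312-5's real lattice situation
(strictified columns), FROM: S (`PilotKummerIndRelated`), the three pins, and the four idele side conditions.** `BridgeHyps` is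
supplied by `bridgeHyps_settingPrVolSharp_of_ideles` (p424856) and Thm. 3.11 (ii) (b) at column `n` by `rfl` (strictified
reading, CAVEAT in the module docstring); the composition is `Cor312Vol.statement_of_pinned3_of_pilotKummerIndRelated` (p418935).
«The Statement follows from S + these hypotheses as typed, at these data» — no side taken. [claim: Mochizuki2012, status: disputed] -/
theorem Shrink1.statement_of_S (htq0 : ∀ pp x, tq pp x ≠ 0)
    (htq1 : ∀ (pp : Nat.Primes) (x : (thetaIndex X).Fibre (.inr pp)),
      haveI : Fact (pp : ℕ).Prime := ⟨pp.2⟩; placeOf X pp.1 x ∉ X.S → ‖tq pp x‖ = 1)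
    (ht0 : ∀ pp i x, t pp i x ≠ 0)
    (ht1 : ∀ (pp : Nat.Primes) (i : Fin X.lstar) (x : (thetaIndex X).Fibre (.inr pp)),
      haveI : Fact (pp : ℕ).Prime := ⟨pp.2⟩; placeOf X pp.1 x ∉ X.S → ‖t pp i x‖ = 1)
    (hS : Cor312Vol.PilotKummerIndRelated
      (LatticeSituation.ofShells (logShellsDH X (analyticLogv F)) M archPk archSub
        (summandPiecesPr X (logvAnalytic_analyticLogv (F := F))).Adm
        (summandPiecesPr X (logvAnalytic_analyticLogv (F := F))).logvol Ψ act Mmod region frobAdm frobLogvol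
        (fun k _ => Ψ k) frobMmod unitImage ballImage thetaDiv)
      (settingPrVolSharp X (logvAnalytic_analyticLogv (F := F)) M archPk archSub Ψ act Mmod region n lat sig split qData
        tq t htq0 htq1) ρ qK)
    (hPin : Cor312Vol.PinnedRegions3
      (LatticeSituation.ofShells (logShellsDH X (analyticLogv F)) M archPk archSub
        (summandPiecesPr X (logvAnalytic_analyticLogv (F := F))).Adm
        (summandPiecesPr X (logvAnalytic_analyticLogv (F := F))).logvol Ψ act Mmod region frobAdm frobLogvol
        (fun k _ => Ψ k) frobMmod unitImage ballImage thetaDiv)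
      (settingPrVolSharp X (logvAnalytic_analyticLogv (F := F)) M archPk archSub Ψ act Mmod region n lat sig split qData
        tq t htq0 htq1) ρ qK) :
    (settingPrVolSharp X (logvAnalytic_analyticLogv (F := F)) M archPk archSub Ψ act Mmod region n lat sig split qData
        tq t htq0 htq1).Statement :=
  Cor312Vol.statement_of_pinned3_of_pilotKummerIndRelated
    (LatticeSituation.ofShells (logShellsDH X (analyticLogv F)) M archPk archSub
      (summandPiecesPr X (logvAnalytic_analyticLogv (F := F))).Adm
      (summandPiecesPr X (logvAnalytic_analyticLogv (F := F))).logvol Ψ act Mmod region frobAdm frobLogvol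
      (fun k _ => Ψ k) frobMmod unitImage ballImage thetaDiv)
    (settingPrVolSharp X (logvAnalytic_analyticLogv (F := F)) M archPk archSub Ψ act Mmod region n lat sig split qData
      tq t htq0 htq1) ρ qK
    -- [PIN] hBridge DISCHARGED: every field of `BridgeHyps` is a theorem at the sharp print-normalised real setting (p424856)
    (bridgeHyps_settingPrVolSharp_of_ideles X (logvAnalytic_analyticLogv (F := F)) M archPk archSub Ψ act Mmod region n lat
      sig split qData t tq ht0 ht1 htq0 htq1)
    -- [CONE] hKumB DISCHARGED: Thm. 3.11 (ii) (b) at column n is `rfl` in the strictified reading (c312-5, Thm311Real3)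
    (fun _ _ _ => rfl) hPin hS

end PerCurve

/-! ## §2. The family: `abc_of_S_v1` CALLED at the genuine real data — `hBridge`, `hKumB` instantiated by name -/

section Family

/-- **`abc_of_S_shrink1` (branch C certificate v1 AT THE GENUINE REAL DATA OF RECORD; explicit `Prop` binders
S 1 · PIN 1 · FACT 0 · CONE 1 · READ 2 · SIDE 4 = 9; v1 binders DISCHARGED: `hBridge`, `hKumB`).** The summit statement
`ABC` from: the apex structure inputs `V`, `T`, `A` (as in `abc_of_S_v1`); per curve `P` a number field `Fld P`, Dupuy–Hilado
pilot data `X P`, the remaining CONTEXT binders of abc-iut-c312-7's print-normalised real setting (archimedean integral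
structures, (b)(c) line data, column data other than the splitting-monoid images, `n`, the lattice / Frobenioid-signature /
splitting-monoid / q-pilot containers, Θ- and q-ideles `t`, `tq`), PR-1's region reading `ρ P` and q-datum `qK P` (DATA); and
the explicit hypotheses [SIDE] `htq0 htq1 ht0 ht1` (ideles non-zero, units off `S`; inhabited by REALISING ideles under
`2l ∣ ord_v(q_v)`, abc-iut-c312-3 `exists_realising_qIdeles`/`_thetaIdeles`) · [S] `hS` · [PIN] `hPin` · [CONE] `hInd` · [READ]
`hΘ`, `hq` — EXACTLY `abc_of_S_v1` with `F P := LatticeSituation.ofShells (logShellsDH (X P) (analyticLogv _)) …` (strictified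
columns), `P312 P := settingPrVolSharp (X P) …`, `hBridge P := bridgeHyps_settingPrVolSharp_of_ideles …` (p424856) and
`hKumB P := rfl` (Thm. 3.11 (ii)(b) in the strictified reading; CAVEAT in the module docstring). «`ABC` follows from S + these
hypotheses as typed, at these data» — no side taken on [IUTchIII] Cor. 3.12; typed ≠ proved; instantiated ≠ endorsed.
[claim: Mochizuki2012, status: disputed] -/
theorem abc_of_S_shrink1
    -- DATA (uncounted): the fork apex's structure inputs
    (V : HeightFamily) (T : Thm110Family V) (A : AbcDictionary V)
    -- DATA, per curve: number field, pilot data, and the context binders of the genuine real setting (logs FIXED: analytic)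
    (Fld : V.Pt → Type) [∀ P, Field (Fld P)] [∀ P, NumberField (Fld P)] (X : ∀ P, PilotData (Fld P))
    (M : V.Pt → Type) [∀ P, Field (M P)] [∀ P, NumberField (M P)]
    (archPk : ∀ P (j : (thetaIndex (X P)).Label) (vQ : (thetaIndex (X P)).VQ),
      Set ((logShellsDH (X P) (analyticLogv (Fld P))).Packet j vQ))
    (archSub : ∀ P (j : (thetaIndex (X P)).Label) (v : (thetaIndex (X P)).V),
      Set ((logShellsDH (X P) (analyticLogv (Fld P))).Packet j ((thetaIndex (X P)).over v)))
    (Ψ : ∀ P, ℤ → ∀ v : (thetaIndex (X P)).V, v ∈ (thetaIndex (X P)).Vbad →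
      Set ((logShellsDH (X P) (analyticLogv (Fld P))).StarPacket v))
    (act : ∀ P, ℤ → ∀ v : (thetaIndex (X P)).V, v ∈ (thetaIndex (X P)).Vbad →
      (logShellsDH (X P) (analyticLogv (Fld P))).StarPacket v →
        Module.End ℚ ((logShellsDH (X P) (analyticLogv (Fld P))).StarPacket v))
    (Mmod : ∀ P, ℤ → ∀ j : (thetaIndex (X P)).LabelStar, Set ((logShellsDH (X P) (analyticLogv (Fld P))).GlobalPacket j.1))
    (region : ∀ P, ℤ → ∀ j : (thetaIndex (X P)).LabelStar, FinDivisor (M P) → ∀ vQ : (thetaIndex (X P)).VQ,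
      Set ((logShellsDH (X P) (analyticLogv (Fld P))).Packet j.1 vQ))
    (frobAdm : ∀ P, ℤ → ℤ → ∀ (j : (thetaIndex (X P)).Label) (vQ : (thetaIndex (X P)).VQ),
      Set ((logShellsDH (X P) (analyticLogv (Fld P))).Packet j vQ) → Prop)
    (frobLogvol : ∀ P, ℤ → ℤ → ∀ (j : (thetaIndex (X P)).Label) (vQ : (thetaIndex (X P)).VQ),
      Set ((logShellsDH (X P) (analyticLogv (Fld P))).Packet j vQ) → ℝ)
    (frobMmod : ∀ P, ℤ → ℤ → ∀ j : (thetaIndex (X P)).LabelStar,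
      Set ((logShellsDH (X P) (analyticLogv (Fld P))).GlobalPacket j.1))
    (unitImage : ∀ P, ℤ → ℤ → ℕ → ∀ (j : (thetaIndex (X P)).Label) (vQ : (thetaIndex (X P)).VQ),
      Set ((logShellsDH (X P) (analyticLogv (Fld P))).Packet j vQ))
    (ballImage : ∀ P, ℤ → ℤ → ∀ (j : (thetaIndex (X P)).Label) (vQ : (thetaIndex (X P)).VQ),
      Set ((logShellsDH (X P) (analyticLogv (Fld P))).Packet j vQ))
    (thetaDiv : ∀ P, ℤ → ℤ → LgpDivisor (M P) (thetaIndex (X P)).lstar)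
    (n : V.Pt → ℤ)
    {HT : V.Pt → Type} {LogLink : ∀ P, HT P → HT P → Type} {IsFull : ∀ P, ∀ {s t : HT P}, LogLink P s t → Prop}
    (lat : ∀ P, LGPGaussianLogThetaLattice (LogLink P) (IsFull P))
    {Frd : V.Pt → Type} {IsoF : ∀ P, Frd P → Frd P → Type} {Ob : ∀ P, Frd P → Type} {realify : ∀ P, Frd P → Frd P}
    {Strip : V.Pt → Type} {IsoS : ∀ P, Strip P → Strip P → Type}
    {Mv : ∀ P, ∀ v : (thetaIndex (X P)).V, v ∈ (thetaIndex (X P)).Vbad → Type} [∀ P v h, Monoid (Mv P v h)]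
    (sig : ∀ P, GlobalLGPFrobenioidSignature (thetaIndex (X P)).lstar (thetaIndex (X P)).V (· ∈ (thetaIndex (X P)).Vbad)
      (Frd P) (IsoF P) (Ob P) (realify P) (Strip P) (IsoS P) (Mv P))
    (split : ∀ P, SplittingMonoids (Mv P))
    {ObΔ : V.Pt → Type} {N : ∀ P, ∀ v : (thetaIndex (X P)).V, v ∈ (thetaIndex (X P)).Vbad → Type} [∀ P v h, Monoid (N P v h)]
    (qData : ∀ P, QPilotData (ObΔ P) (N P))
    (t : ∀ P (pp : Nat.Primes) (_ : Fin (X P).lstar) (x : (thetaIndex (X P)).Fibre (.inr pp)),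
      haveI : Fact (pp : ℕ).Prime := ⟨pp.2⟩; kOf (X P) pp.1 x)
    (tq : ∀ P (pp : Nat.Primes) (x : (thetaIndex (X P)).Fibre (.inr pp)),
      haveI : Fact (pp : ℕ).Prime := ⟨pp.2⟩; kOf (X P) pp.1 x)
    (ρ : ∀ P, (∀ v : (thetaIndex (X P)).V, v ∈ (thetaIndex (X P)).Vbad →
        Set ((logShellsDH (X P) (analyticLogv (Fld P))).StarPacket v)) →
      ∀ (j : (thetaIndex (X P)).Label) (vQ : (thetaIndex (X P)).VQ), Set ((logShellsDH (X P) (analyticLogv (Fld P))).Packet j vQ))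
    (qK : ∀ P, ∀ v : (thetaIndex (X P)).V, v ∈ (thetaIndex (X P)).Vbad →
      Set ((logShellsDH (X P) (analyticLogv (Fld P))).StarPacket v))
    -- [SIDE] the ideles are non-zero and units off `S` (inhabited by realising ideles, c312-3 p420764)
    (htq0 : ∀ P pp x, tq P pp x ≠ 0)
    (htq1 : ∀ P (pp : Nat.Primes) (x : (thetaIndex (X P)).Fibre (.inr pp)),
      haveI : Fact (pp : ℕ).Prime := ⟨pp.2⟩; placeOf (X P) pp.1 x ∉ (X P).S → ‖tq P pp x‖ = 1)
    (ht0 : ∀ P pp i x, t P pp i x ≠ 0)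
    (ht1 : ∀ P (pp : Nat.Primes) (i : Fin (X P).lstar) (x : (thetaIndex (X P)).Fibre (.inr pp)),
      haveI : Fact (pp : ℕ).Prime := ⟨pp.2⟩; placeOf (X P) pp.1 x ∉ (X P).S → ‖t P pp i x‖ = 1)
    -- [S] the single named proposition, at every curve, AT THESE DATA
    (hS : ∀ P, Cor312Vol.PilotKummerIndRelated
      (LatticeSituation.ofShells (logShellsDH (X P) (analyticLogv (Fld P))) (M P) (archPk P) (archSub P)
          (summandPiecesPr (X P) (logvAnalytic_analyticLogv (F := Fld P))).Adm
          (summandPiecesPr (X P) (logvAnalytic_analyticLogv (F := Fld P))).logvol (Ψ P) (act P) (Mmod P) (region P)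
          (frobAdm P) (frobLogvol P) (fun k _ => Ψ P k) (frobMmod P) (unitImage P) (ballImage P) (thetaDiv P))
      (settingPrVolSharp (X P) (logvAnalytic_analyticLogv (F := Fld P)) (M P) (archPk P) (archSub P) (Ψ P) (act P) (Mmod P)
          (region P) (n P) (lat P) (sig P) (split P) (qData P) (tq P) (t P) (htq0 P) (htq1 P)) (ρ P) (qK P))
    -- [PIN] the Corollary's own pins (pΘ)(pq′)(pL), AT THESE DATA (`hBridge` is no longer a binder: p424856)
    (hPin : ∀ P, Cor312Vol.PinnedRegions3
      (LatticeSituation.ofShells (logShellsDH (X P) (analyticLogv (Fld P))) (M P) (archPk P) (archSub P)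
          (summandPiecesPr (X P) (logvAnalytic_analyticLogv (F := Fld P))).Adm
          (summandPiecesPr (X P) (logvAnalytic_analyticLogv (F := Fld P))).logvol (Ψ P) (act P) (Mmod P) (region P)
          (frobAdm P) (frobLogvol P) (fun k _ => Ψ P k) (frobMmod P) (unitImage P) (ballImage P) (thetaDiv P))
      (settingPrVolSharp (X P) (logvAnalytic_analyticLogv (F := Fld P)) (M P) (archPk P) (archSub P) (Ψ P) (act P) (Mmod P)
          (region P) (n P) (lat P) (sig P) (split P) (qData P) (tq P) (t P) (htq0 P) (htq1 P)) (ρ P) (qK P))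
    -- [FACT] (none on this path)
    -- [CONE] the apex node `MochizukiIndeterminacies` (`hKumB` is no longer a binder: `rfl` in the strictified reading)
    (hInd : DAG.N_IUTchIII_Thm3_11_MultiradialEstimate T)
    -- [READ] the genuine setting's `−|log(Θ)|` (when finite) and `−|log(q)|` are the curve's Thm-1.10 numbers
    (hΘ : ∀ P (x : ℝ),
      (settingPrVolSharp (X P) (logvAnalytic_analyticLogv (F := Fld P)) (M P) (archPk P) (archSub P) (Ψ P) (act P) (Mmod P)
          (region P) (n P) (lat P) (sig P) (split P) (qData P) (tq P) (t P) (htq0 P) (htq1 P)).negLogTheta = (x : WithTop ℝ) →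
        (T.X P).negLogTheta = x)
    (hq : ∀ P,
      (settingPrVolSharp (X P) (logvAnalytic_analyticLogv (F := Fld P)) (M P) (archPk P) (archSub P) (Ψ P) (act P) (Mmod P)
          (region P) (n P) (lat P) (sig P) (split P) (qData P) (tq P) (t P) (htq0 P) (htq1 P)).negLogQ = -(T.X P).absLogq) :
    _root_.ABC :=
  -- Step 3 of `abc_of_S_v1`: the apex `DAG.summit_of_cor312` (kernel_hyps = 2), `h312` supplied per curve by Steps 1–2
  DAG.summit_of_cor312 V T A hInd fun P => by
    -- Step 1: the verbatim Statement at the genuine setting — `hBridge` := p424856, `hKumB` := rfl (§1)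
    have hst := Shrink1.statement_of_S (X P) (M P) (archPk P) (archSub P) (Ψ P) (act P) (Mmod P) (region P) (frobAdm P)
      (frobLogvol P) (frobMmod P) (unitImage P) (ballImage P) (thetaDiv P) (n P) (lat P) (sig P) (split P) (qData P) (t P)
      (tq P) (ρ P) (qK P) (htq0 P) (htq1 P) (ht0 P) (ht1 P) (hS P) (hPin P)
    -- Step 2: read it on the curve's Thm-1.10 numbers (c312-7 `statement_iff_real` + `hΘ`, `hq`), exactly as in `abc_of_S_v1`
    obtain ⟨x, hx⟩ := WithTop.ne_top_iff_exists.mp hst.1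
    have hle := (Cor312.Setting.statement_iff_real _ hx.symm).mp hst
    show -(T.X P).absLogq ≤ (T.X P).negLogTheta
    rw [hΘ P x hx.symm, ← hq P]
    exact hle

end Family

end Summit.ABC.IUTFork.Conditional

end
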